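import Mathlib
import Summits.NavierStokesRegularity.NavierStokesRegularity.Theses.SubcriticalEnvelope
import Summits.NavierStokesRegularity.NavierStokesRegularity.Theorems.SubcriticalEnvelopeForwardSourceSmoothingFar
import Summits.NavierStokesRegularity.NavierStokesRegularity.Theorems.SubcriticalEnvelopeForwardSourceSmoothingNear
import Literature.Analysis.FluidPDE.Tao2016AveragedNS.ViscousEnvelopeSmoothing
import HarnessLib

/-!
# `SubcriticalEnvelope.ForwardSourceSmoothing` (stmt-NavierStokesRegularity-26374, crux B⁺) — a
second, independent proof by SLAVING OF THE NON-SOURCE MODES (the item was closed first by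
`Theorems.forwardSourceSmoothing_proof`, route OrthantWake, via the whole-shell energy identity and
bond fluxes; this file completes the alternative chain p613050 → p613704 → p614281 → p614960 of this
seat, whose far-shell lemma gives the sharper statement that the non-source modes inherit the FULL
source exponent beyond the crossover in one step)

**Statement (verbatim route decl).** For a table `α ∈ E₂(R)`, a mode set `S` containing every
forward source (`i ∉ S ⇒ α i j l (0,0,1) = 0`), a one-shell datum `X₀`, `ε₀ > 0`, `η > 0` and a
viscosity `ν > 0`: if on every horizon `T` one constant `C(T)` bounds the `S`-mode partial tail
energies `Σ_{k=n}^{N} Σ_{i∈S} ½X_{i,k}(t)²` of every regular `ν`-viscous lattice solution on every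
sub-window `[0,s] ⊆ [0,T]` by `C(1+ε₀)^{-(1+η)n}`, then the `ν`-viscous lattice has a GLOBAL regular
solution from `X₀` (`ViscousGlobal ε₀ ν α X₀ X`).

PROOF (slaving of the non-source modes, then the landed engine). Fix `T` and `C = C(T)`; put
`η₁ = min η 1`, `γ = (1+η₁)/2`, `A = √(2C)`, `L = 4³`. For a regular solution on `[0,s] ⊆ [0,T]`
the sources obey `|X_{i,k}| ≤ A(1+ε₀)^{-γk}`. The non-source energies `y_k = Σ_{d∉S} ½X_{d,k}²` obey
`y_k' = Φ^D_k − 2ν(1+ε₀)^{2k}y_k` where, by the cancellations of stage α (pure-`D` in-shell triads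
and `D`-partnered two-shell rotors move no `D`-energy), the flux `Φ^D_k` is linear in `y_k` with
rate `≍ (1+ε₀)^{(2−η₁/2)k}` plus a forcing quadratic in the source envelope and catalysed by
`√y_{k+1}` (stages α, β).  Beyond a `ν`-dependent crossover `n₁` the dissipation dominates and the
weighted energies satisfy `V_k ≤ E₁ + ½V_{k+1}`; started from the (solution-dependent) a priori
weight and iterated, this gives the solution-INDEPENDENT bound `y_k ≤ 2E₁(1+ε₀)^{-2γk}`, `k ≥ n₁`
(stage γ₁).  The finitely many shells below `n₁` are bounded by downward Grönwall with `T`-dependent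
constants (stage γ₂).  Summing, ALL modes obey a subcritical envelope `C_all(T)(1+ε₀)^{-(1+η₁)n}`
on every sub-window, and the landed engine
`exists_viscousGlobal_of_subcriticalEnvelope_of_inTableClass` (damped Picard + continuation +
dissipation bootstrap, p593260) returns the global regular solution.

HONEST FRAMING: a statement about Tao-type MODEL lattice ODEs (route SubcriticalEnvelope, rung
TL-M2Break): at FIXED viscosity, a forward-source envelope smooths the lattice.  It says nothing
about the `ν`-uniform crux A⁺ (`ForwardSourceTailEnvelope`), nothing about the Navier–Stokes
equations, and no summit is proved.
-/

noncomputable section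

-- the sub-problem namespace `NavierStokesRegularity.NavierStokesRegularity` is the tree's layout (D-0017)
set_option linter.dupNamespace false

namespace Summit.NavierStokesRegularity.NavierStokesRegularity.Theorems

open Set Finset
open Literature.Analysis.FluidPDE.TaoCascade

/-- Choice of the crossover shell: for `b > 1`, `γ > 1/2`, `ν > 0` and any reals `L, A, Q` there is
`n₁ ≥ 1` such that for all `k ≥ n₁` both `4L b^{5k/2}(A b^{-γk}) ≤ ν b^{2k}/2` and
`Q·b^{(1−2γ)k} ≤ ½` (the two crossover conditions of `forwardSourceSmoothing_far_shells`; geometric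
growth of `b^{(γ−1/2)k}` and `b^{(2γ−1)k}`). [folklore] -/
theorem forwardSourceSmoothing_exists_crossover {b L A ν γ Q : ℝ} (hb : 1 < b) (hν : 0 < ν)
    (hγ : 1 / 2 < γ) :
    ∃ n₁ : ℕ, 1 ≤ n₁ ∧
      (∀ k : ℕ, n₁ ≤ k → 4 * L * b ^ ((5 : ℝ) * (k : ℝ) / 2) * (A * b ^ (-(γ * (k : ℝ)))) ≤
        ν * b ^ ((2 : ℝ) * (k : ℝ)) / 2) ∧
      (∀ k : ℕ, n₁ ≤ k → Q * b ^ ((1 - 2 * γ) * (k : ℝ)) ≤ 1 / 2) := by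
  have hb0 : 0 < b := by linarith
  -- the two growth factors
  have hρ₁ : 1 < b ^ (γ - 1 / 2) := Real.one_lt_rpow hb (by linarith)
  have hρ₂ : 1 < b ^ (2 * γ - 1) := Real.one_lt_rpow hb (by linarith)
  obtain ⟨Na, hNa⟩ := pow_unbounded_of_one_lt (8 * L * A / ν) hρ₁
  obtain ⟨Nb, hNb⟩ := pow_unbounded_of_one_lt (2 * Q) hρ₂
  refine ⟨max 1 (max Na Nb), le_max_left _ _, fun k hk => ?_, fun k hk => ?_⟩
  · have hkN : Na ≤ k := (le_max_left _ _).trans ((le_max_right _ _).trans hk)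
    have h1 : 8 * L * A / ν < (b ^ (γ - 1 / 2)) ^ k :=
      hNa.trans_le (pow_le_pow_right₀ hρ₁.le hkN)
    rw [div_lt_iff₀ hν, ← Real.rpow_mul_natCast hb0.le] at h1
    have hP : 0 < b ^ ((5 / 2 - γ) * (k : ℝ)) := Real.rpow_pos_of_pos hb0 _
    have h2 : 8 * L * A * b ^ ((5 / 2 - γ) * (k : ℝ)) ≤ ν * b ^ ((2 : ℝ) * (k : ℝ)) := by
      calc 8 * L * A * b ^ ((5 / 2 - γ) * (k : ℝ))
          ≤ b ^ ((γ - 1 / 2) * (k : ℝ)) * ν * b ^ ((5 / 2 - γ) * (k : ℝ)) :=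
            mul_le_mul_of_nonneg_right h1.le hP.le
        _ = ν * (b ^ ((γ - 1 / 2) * (k : ℝ)) * b ^ ((5 / 2 - γ) * (k : ℝ))) := by ring
        _ = ν * b ^ ((2 : ℝ) * (k : ℝ)) := by rw [← Real.rpow_add hb0]; ring_nf
    have h3 : 4 * L * b ^ ((5 : ℝ) * (k : ℝ) / 2) * (A * b ^ (-(γ * (k : ℝ)))) =
        (8 * L * A * b ^ ((5 / 2 - γ) * (k : ℝ))) / 2 := by
      rw [show (5 / 2 - γ) * (k : ℝ) = (5 : ℝ) * (k : ℝ) / 2 + -(γ * (k : ℝ)) by ring,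
        Real.rpow_add hb0]
      ring
    rw [h3]
    linarith
  · have hkN : Nb ≤ k := (le_max_right _ _).trans ((le_max_right _ _).trans hk)
    have h1 : 2 * Q < (b ^ (2 * γ - 1)) ^ k := hNb.trans_le (pow_le_pow_right₀ hρ₂.le hkN)
    rw [← Real.rpow_mul_natCast hb0.le] at h1
    have hP : 0 < b ^ ((2 * γ - 1) * (k : ℝ)) := Real.rpow_pos_of_pos hb0 _
    have h2 : b ^ ((1 - 2 * γ) * (k : ℝ)) = (b ^ ((2 * γ - 1) * (k : ℝ)))⁻¹ := by
      rw [← Real.rpow_neg hb0.le]; ring_nf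
    rw [h2, ← div_eq_mul_inv, div_le_iff₀ hP]
    linarith

/-- **Item stmt-NavierStokesRegularity-26374** (`SubcriticalEnvelope.ForwardSourceSmoothing`,
crux B⁺; independent second proof — the item is already closed by `forwardSourceSmoothing_proof`):
at fixed viscosity `ν > 0`, a window-wise subcritical envelope of the FORWARD-SOURCE
partial tail energies of the regular `ν`-viscous cascade lattice solutions (mode set `S ∋` every
forward source of the table `α ∈ E₂(R)`) yields a global regular viscous solution
(`ViscousGlobal ε₀ ν α X₀ X`): the non-source modes are slaved to the sources (stages α, β, γ₁, γ₂ of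
this seat) and the landed engine `exists_viscousGlobal_of_subcriticalEnvelope_of_inTableClass`
concludes.  MODEL lattice statement; nothing about Navier–Stokes regularity is proved.
[this file] -/
theorem subcriticalEnvelope_forwardSourceSmoothing_proof :
    Summit.NavierStokesRegularity.NavierStokesRegularity.Theses.SubcriticalEnvelope.ForwardSourceSmoothing := by
  unfold Summit.NavierStokesRegularity.NavierStokesRegularity.Theses.SubcriticalEnvelope.ForwardSourceSmoothing
  intro ε₀ η R hε₀ hη α hα S hS X₀ ν hν henvS
  -- the reduced margin and exponent
  set η₁ : ℝ := min η 1 with hη₁def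
  have hη₁ : 0 < η₁ := lt_min hη one_pos
  have hη₁η : η₁ ≤ η := min_le_left _ _
  have hη₁1 : η₁ ≤ 1 := min_le_right _ _
  set γ : ℝ := (1 + η₁) / 2 with hγdef
  have hγ : 1 / 2 < γ := by rw [hγdef]; linarith
  have hγ1 : γ ≤ 1 := by rw [hγdef]; linarith
  have h2γ : ∀ x : ℝ, 2 * γ * x = (1 + η₁) * x := fun x => by rw [hγdef]; ring
  set b : ℝ := 1 + ε₀ with hb
  have hb1 : 1 < b := by rw [hb]; linarith
  have hb0 : 0 < b := by linarith
  -- the table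
  have hsym : IsSymmetricCoeff α := hα.1
  have hcan : IsCancellingCoeff α := hα.2.1
  have hbd : ∀ i₁ i₂ i₃ μ, μ ∈ shiftSet → |α i₁ i₂ i₃ μ| ≤ (1 : ℝ) := abs_le_one_of_inTableClass hα
  set L : ℝ := ((4 : ℕ) : ℝ) ^ 3 * (1 : ℝ) with hL
  have hL0 : 0 ≤ L := by positivity
  refine exists_viscousGlobal_of_subcriticalEnvelope_of_inTableClass hε₀.le hη₁ hν hα X₀ fun T hT => ?_
  obtain ⟨C, hC⟩ := henvS T hT
  -- constants for this horizon
  set C' : ℝ := max C 0 with hC'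
  have hC'0 : 0 ≤ C' := le_max_right _ _
  set A : ℝ := Real.sqrt (2 * C') with hA
  have hA0 : 0 ≤ A := Real.sqrt_nonneg _
  obtain ⟨n₁, hn₁, hdom, hθ⟩ := forwardSourceSmoothing_exists_crossover (L := L) (A := A)
    (Q := 16 * L ^ 2 * A ^ 2 * b ^ (-(2 * γ)) / ν ^ 2) hb1 hν hγ
  set E₁ : ℝ := 2 * L ^ 2 * A ^ 4 * (4 + b ^ (2 * γ)) ^ 2 / ν ^ 2 with hE₁
  have hE₁0 : 0 ≤ E₁ := by positivity
  set F : ℝ := 2 * E₁ with hF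
  have hF0 : 0 ≤ F := by positivity
  set e₀ : ℝ := ∑ i, (1 / 2 : ℝ) * X₀ i ^ 2 with he₀
  have he₀0 : 0 ≤ e₀ := Finset.sum_nonneg fun i _ => by positivity
  set rmax : ℝ := 4 * L * b ^ ((5 : ℝ) * (n₁ : ℝ) / 2) * A + 1 with hrmax
  let Λseq : ℕ → ℝ := fun j => Nat.rec F (fun _ Λj => (e₀ + (L * b ^ ((5 : ℝ) * (n₁ : ℝ) / 2) *
    (4 * A ^ 2 + 2 * A * Real.sqrt (2 * Λj) + A ^ 2 * b ^ (2 * γ))) ^ 2 / 2 * T) *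
      Real.exp (rmax * T)) j
  have hΛ0 : Λseq 0 = F := rfl
  have hΛS : ∀ j, Λseq (j + 1) = (e₀ + (L * b ^ ((5 : ℝ) * (n₁ : ℝ) / 2) *
      (4 * A ^ 2 + 2 * A * Real.sqrt (2 * Λseq j) + A ^ 2 * b ^ (2 * γ))) ^ 2 / 2 * T) *
        Real.exp (rmax * T) := fun j => rfl
  have hΛpos : ∀ j, 0 ≤ Λseq j := fun j => by
    cases j with
    | zero => rw [hΛ0]; exact hF0
    | succ j => rw [hΛS]; positivity
  set Λs : ℝ := ∑ j ∈ Finset.range (n₁ + 1), Λseq j with hΛs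
  set KD : ℝ := (n₁ : ℝ) * Λs * b ^ (2 * γ * (n₁ : ℝ)) + F / (1 - b ^ (-(2 * γ))) with hKD
  refine ⟨C' + KD, fun s hs X hinit hlow hbdd hcont hder n N hnN t ht => ?_⟩
  -- exponent comparison `b^{-(1+η)k} ≤ b^{-2γk}`
  have hexp : ∀ k : ℕ, b ^ (-((1 + η) * (k : ℝ))) ≤ b ^ (-(2 * γ * (k : ℝ))) := fun k =>
    Real.rpow_le_rpow_of_exponent_le hb1.le (by
      rw [h2γ]; have : (0 : ℝ) ≤ k := Nat.cast_nonneg k; nlinarith)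
  -- the source envelope, shell by shell, and the source amplitudes
  have hSenv : ∀ (k : ℕ), ∀ τ ∈ Icc (0 : ℝ) s,
      ∑ i ∈ S, (1 / 2 : ℝ) * X i k τ ^ 2 ≤ C' * b ^ (-(2 * γ * (k : ℝ))) := by
    intro k τ hτ
    have h := hC s hs X hinit hlow hbdd hcont hder k k le_rfl τ hτ
    rw [Finset.Icc_self, Finset.sum_singleton] at h
    exact h.trans ((mul_le_mul_of_nonneg_right (le_max_left C 0) (Real.rpow_nonneg hb0.le _)).trans
      (mul_le_mul_of_nonneg_left (hexp k) hC'0))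
  have hSb : ∀ (k : ℕ), ∀ τ ∈ Icc (0 : ℝ) s, ∀ i ∈ S, |X i k τ| ≤ A * b ^ (-(γ * (k : ℝ))) := by
    intro k τ hτ i hi
    have h1 : (1 / 2 : ℝ) * X i k τ ^ 2 ≤ C' * b ^ (-(2 * γ * (k : ℝ))) :=
      (Finset.single_le_sum (f := fun i => (1 / 2 : ℝ) * X i k τ ^ 2) (fun j _ => by positivity)
        hi).trans (hSenv k τ hτ)
    have hu2 : (b ^ (-(γ * (k : ℝ)))) ^ 2 = b ^ (-(2 * γ * (k : ℝ))) := by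
      rw [sq, ← Real.rpow_add hb0]; ring_nf
    have h2 : X i k τ ^ 2 ≤ (A * b ^ (-(γ * (k : ℝ)))) ^ 2 := by
      rw [mul_pow, hu2, hA, Real.sq_sqrt (by positivity)]
      linarith
    exact abs_le_of_sq_le_sq' h2 (by positivity) |>.elim fun h3 h4 => abs_le.2 ⟨h3, h4⟩
  -- far shells
  have h0 : ∀ i (k : ℤ), k ≠ 0 → X i k 0 = 0 := fun i k hk => by rw [hinit, if_neg hk]
  have hfar := forwardSourceSmoothing_far_shells (Mα := 1) hε₀ hν zero_le_one hA0 hγ.le hγ1 hsym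
    hcan hbd S hS h0 hbdd hcont hder hSb hn₁ (fun k hk => by
      have h := hdom k hk; rw [hL] at h; exact h) (fun k hk => hθ k hk)
  -- near shells
  have he₀k : ∀ k : ℕ, ∑ d ∈ Sᶜ, (1 / 2 : ℝ) * X d k 0 ^ 2 ≤ e₀ := by
    intro k
    rcases Nat.eq_zero_or_pos k with hk | hk
    · subst hk
      have : ∑ d ∈ Sᶜ, (1 / 2 : ℝ) * X d ((0 : ℕ) : ℤ) 0 ^ 2 = ∑ d ∈ Sᶜ, (1 / 2 : ℝ) * X₀ d ^ 2 :=
        Finset.sum_congr rfl fun d _ => by rw [Nat.cast_zero, hinit, if_pos rfl]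
      rw [this, he₀]
      exact Finset.sum_le_univ_sum_of_nonneg fun i => by positivity
    · rw [Finset.sum_eq_zero fun d _ => by rw [h0 d k (by omega)]; ring]
      exact he₀0
  have hfar0 : ∀ τ ∈ Icc (0 : ℝ) s, ∑ d ∈ Sᶜ, (1 / 2 : ℝ) * X d (n₁ : ℕ) τ ^ 2 ≤ Λseq 0 := by
    intro τ hτ
    refine (hfar n₁ le_rfl τ hτ).trans ?_
    rw [hΛ0]
    exact mul_le_of_le_one_right hF0 (Real.rpow_le_one_of_one_le_of_nonpos hb1.le (by
      have : (0 : ℝ) ≤ n₁ := Nat.cast_nonneg n₁; nlinarith))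
  have hnear := forwardSourceSmoothing_near_shells (Mα := 1) hε₀ hν.le zero_le_one hA0
    (by linarith : (0 : ℝ) ≤ γ) hs.2 hsym hcan hbd S hS hlow hcont hder hSb he₀k Λseq hfar0
    (fun j => le_of_eq (by rw [hΛS j]))
  -- the non-source tail sum
  have hD := forwardSourceSmoothing_tail_sum_le (y := fun k : ℕ => ∑ d ∈ Sᶜ, (1 / 2 : ℝ) * X d k t ^ 2)
    (Λ := Λseq) hb1 (by linarith) hΛpos hF0 (fun j hj => hnear j hj t ht)
    (fun k hk => hfar k hk t ht) n N
  -- the source part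
  have hSpart : ∑ k ∈ Finset.Icc n N, ∑ i ∈ S, (1 / 2 : ℝ) * X i (k : ℤ) t ^ 2 ≤
      C' * b ^ (-(2 * γ * (n : ℝ))) :=
    (hC s hs X hinit hlow hbdd hcont hder n N hnN t ht).trans
      ((mul_le_mul_of_nonneg_right (le_max_left C 0) (Real.rpow_nonneg hb0.le _)).trans
        (mul_le_mul_of_nonneg_left (hexp n) hC'0))
  -- assemble
  have hsplit : ∑ k ∈ Finset.Icc n N, ∑ i, (1 / 2 : ℝ) * X i (k : ℤ) t ^ 2 =
      ∑ k ∈ Finset.Icc n N, ∑ i ∈ S, (1 / 2 : ℝ) * X i (k : ℤ) t ^ 2 +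
      ∑ k ∈ Finset.Icc n N, ∑ d ∈ Sᶜ, (1 / 2 : ℝ) * X d (k : ℤ) t ^ 2 := by
    rw [← Finset.sum_add_distrib]
    exact Finset.sum_congr rfl fun k _ => (Finset.sum_add_sum_compl S _).symm
  have hD' : ∑ k ∈ Finset.Icc n N, ∑ d ∈ Sᶜ, (1 / 2 : ℝ) * X d (k : ℤ) t ^ 2 ≤
      KD * b ^ (-(2 * γ * (n : ℝ))) := hD
  have hring : C' * b ^ (-(2 * γ * (n : ℝ))) + KD * b ^ (-(2 * γ * (n : ℝ))) =
      (C' + KD) * b ^ (-(2 * γ * (n : ℝ))) := by ring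
  have final : ∑ k ∈ Finset.Icc n N, ∑ i, (1 / 2 : ℝ) * X i (k : ℤ) t ^ 2 ≤
      (C' + KD) * b ^ (-(2 * γ * (n : ℝ))) := by
    rw [hsplit]; linarith [hD', hSpart, hring]
  rw [hb, h2γ] at final
  exact final

end Summit.NavierStokesRegularity.NavierStokesRegularity.Theorems

end
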